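import Mathlib
import Literature.Analysis.PDE.DAlembertSmooth
import Literature.Analysis.PDE.InverseSquareLadderWave
import Literature.Analysis.PDE.InverseSquareChannelEstimateCompact
import Literature.Analysis.ODE.InverseSquareLadderPreimageVanishing
import Literature.Analysis.ODE.LadderIsometryDensity
import Literature.Analysis.ODE.LadderKernel
import HarnessLib

/-!
# The regular exact inverse-square wave of data supported off a ball, and its energy identity

Analysis/PDE support file (everything proved, no definitions). Fix `n ≥ 1`, a smooth `ι` with
`ι = 1/x` on `[½, ∞)` (smooth primitive `I`), and Cauchy data `h ∈ C²`, `g ∈ C¹` supported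
in `[R₁, B]`, `1 < R₁ ≤ B`. We construct (`exists_regularWave`) an explicit global `C²` function
`φ(t,·) = ladder ι n (Φ(t,·))`, `Φ(t,x) = F(x−t) + G(x+t)` a free `C^{n+2}` wave, such that

* `φ` solves `φ_tt = φ_xx − n(n+1)ι²φ` for `x > ½` (all `t`) and has Cauchy data `(h, g)` on `x > ½`;
* `φ = 0` on `{½ < x < R₁ − |t|}` (it is the REGULAR solution: its pre-image data are the odd
  polynomial continuations, of degree `< 2n`, of the ladder pre-images of `(h, g)` across the gap
  `(0, R₁)`, so near such points `Φ(t,·)` is an odd polynomial of degree `< 2n` in `x` and is killed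
  by the ladder — `LadderKernel.lean`, `LadderGap.lean`);
* the profiles are constant beyond `B` with `F + G = 0` there;
* **the energy identity** `∫_{R₁}^B h′² + n(n+1)ι²h² + g² = 2∫_0^B (F⁽ⁿ⁺¹⁾)² + 2∫_0^B (G⁽ⁿ⁺¹⁾)²`
  with constant exactly one (`LadderIsometry.lean`, at the natural regularity via
  `LadderIsometryDensity.lean`).

With the channel-limit identities of `InverseSquareChannelIdentity(Reversed).lean` this gives the
1-D form of the odd-dimensional exterior-energy identity with apex at the centre
(`InverseSquareExteriorEnergyIdentity.lean`; Duyckaerts–Kenig–Merle, Kenig–Lawrie–Liu–Schlag 2015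
§2, Côte–Laurent 2024), uniformly in `n` — the far-side input of route PhotonSphereChannels,
`WindowedShellChannels` (stmt-FinalStateConjecture-14085). Folklore.
-/

noncomputable section

namespace Literature.Analysis.PDE

open Set Filter Topology MeasureTheory Finset Polynomial Literature.Analysis.ODE

variable {ι : ℝ → ℝ}

/-! ### The regular wave -/

/-- **The regular exact inverse-square wave of data supported off a ball.** See the module docstring.
[cite: KenigEtAl2015, §2] -/
theorem exists_regularWave (hι : ContDiff ℝ (⊤ : ℕ∞) ι) (hιeq : ∀ x : ℝ, 1 / 2 ≤ x → ι x = x⁻¹)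
    {I : ℝ → ℝ} (hI : ContDiff ℝ (⊤ : ℕ∞) I) (hI' : ∀ x, HasDerivAt I (ι x) x) {n : ℕ} (hn : 1 ≤ n)
    {h g : ℝ → ℝ} (hh : ContDiff ℝ 2 h) (hg : ContDiff ℝ 1 g)
    {R₁ B : ℝ} (hR₁ : 1 < R₁) (hR₁B : R₁ ≤ B) (hh0 : ∀ x, x ≤ R₁ → h x = 0)
    (hg0 : ∀ x, x ≤ R₁ → g x = 0) (hhB : ∀ x, B ≤ x → h x = 0) (hgB : ∀ x, B ≤ x → g x = 0) :
    ∃ (Φ : ℝ → ℝ → ℝ) (F G : ℝ → ℝ),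
      ContDiff ℝ ((n + 2 : ℕ) : ℕ∞) (Function.uncurry Φ) ∧
      ContDiff ℝ ((n + 2 : ℕ) : ℕ∞) F ∧ ContDiff ℝ ((n + 2 : ℕ) : ℕ∞) G ∧
      (∀ t x, Φ t x = F (x - t) + G (x + t)) ∧
      (∀ x, B ≤ x → F x = F B) ∧ (∀ x, B ≤ x → G x = -F B) ∧
      ContDiff ℝ 2 (Function.uncurry fun t => ladder ι n (Φ t)) ∧
      (∀ t, ∀ x ∈ Ioi (1 / 2 : ℝ), iteratedDeriv 2 (fun τ => ladder ι n (Φ τ) x) t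
        = iteratedDeriv 2 (ladder ι n (Φ t)) x - n * (n + 1) * ι x ^ 2 * ladder ι n (Φ t) x) ∧
      (∀ x, 1 / 2 < x → ladder ι n (Φ 0) x = h x) ∧
      (∀ x, 1 / 2 < x → deriv (fun τ => ladder ι n (Φ τ) x) 0 = g x) ∧
      (∀ t x, 1 / 2 < x → x + |t| < R₁ → ladder ι n (Φ t) x = 0) ∧
      (∫ x in R₁..B, deriv h x ^ 2 + n * (n + 1) * ι x ^ 2 * h x ^ 2 + g x ^ 2)
        = 2 * (∫ y in (0 : ℝ)..B, iteratedDeriv (n + 1) F y ^ 2)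
          + 2 * ∫ y in (0 : ℝ)..B, iteratedDeriv (n + 1) G y ^ 2 := by
  have hSo : IsOpen (Ioi (1 / 2 : ℝ)) := isOpen_Ioi
  have hric : ∀ x ∈ Ioi (1 / 2 : ℝ), deriv ι x = -(ι x) ^ 2 := riccati_of_inv hιeq
  have hιeq' : ∀ x : ℝ, 1 / 2 < x → ι x = x⁻¹ := fun x hx => hιeq x hx.le
  -- Step 1: pre-images based at `B`
  obtain ⟨ht, htC, htlad, ht0⟩ := exists_ladder_preimage_vanishing hI hI' B n hh hhB
  obtain ⟨gt, gtC, gtlad, gt0⟩ := exists_ladder_preimage_vanishing hI hI' B n hg hgB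
  have htC' : ContDiff ℝ ((n + 2 : ℕ) : ℕ∞) ht := by
    have : 2 + n = n + 2 := by ring
    rw [← this]; exact htC
  have gtC' : ContDiff ℝ ((n + 1 : ℕ) : ℕ∞) gt := by
    have : 1 + n = n + 1 := by ring
    rw [← this]; exact gtC
  -- Step 2: on `(½, R₁)` the pre-images are odd polynomials of degree `< 2n`
  have htn : ContDiff ℝ n ht := htC'.of_le (by exact_mod_cast (by omega : n ≤ n + 2))
  have gtn : ContDiff ℝ n gt := gtC'.of_le (by exact_mod_cast (by omega : n ≤ n + 1))
  have hladh0 : ∀ x ∈ Ioo (1 / 2 : ℝ) R₁, ladder ι n ht x = 0 := fun x hx => by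
    rw [htlad]; exact hh0 x hx.2.le
  have hladg0 : ∀ x ∈ Ioo (1 / 2 : ℝ) R₁, ladder ι n gt x = 0 := fun x hx => by
    rw [gtlad]; exact hg0 x hx.2.le
  obtain ⟨p, hpodd, hp2n, hpeq⟩ := exists_polynomial_of_ladder_eq_zero hι hιeq n htn le_rfl hladh0
  obtain ⟨q, hqodd, hq2n, hqeq⟩ := exists_polynomial_of_ladder_eq_zero hι hιeq n gtn le_rfl hladg0
  have hpdeg : p.natDegree < 2 * n := by
    have : p.natDegree ≤ 2 * n - 1 :=
      (natDegree_le_iff_coeff_eq_zero).2 fun i hi => hp2n i (by omega)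
    omega
  have hqdeg : q.natDegree < 2 * n := by
    have : q.natDegree ≤ 2 * n - 1 :=
      (natDegree_le_iff_coeff_eq_zero).2 fun i hi => hq2n i (by omega)
    omega
  -- Step 3: glue the polynomial continuation on `(−∞, R₁)` to the pre-image on `(½, ∞)`
  set hs : ℝ → ℝ := fun x => if x < 1 then p.eval x else ht x with hhs
  set gs : ℝ → ℝ := fun x => if x < 1 then q.eval x else gt x with hgs
  have hs_lo : ∀ x, x < R₁ → hs x = p.eval x := by
    intro x hx
    by_cases h1 : x < 1
    · simp [hhs, h1]
    · simp only [hhs, h1, if_false]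
      exact hpeq x ⟨by linarith, hx⟩
  have hs_hi : ∀ x, 1 / 2 < x → hs x = ht x := by
    intro x hx
    by_cases h1 : x < 1
    · simp only [hhs, h1, if_true]
      exact (hpeq x ⟨hx, by linarith⟩).symm
    · simp [hhs, h1]
  have gs_lo : ∀ x, x < R₁ → gs x = q.eval x := by
    intro x hx
    by_cases h1 : x < 1
    · simp [hgs, h1]
    · simp only [hgs, h1, if_false]
      exact hqeq x ⟨by linarith, hx⟩
  have gs_hi : ∀ x, 1 / 2 < x → gs x = gt x := by
    intro x hx
    by_cases h1 : x < 1
    · simp only [hgs, h1, if_true]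
      exact (hqeq x ⟨hx, by linarith⟩).symm
    · simp [hgs, h1]
  have hsC : ContDiff ℝ ((n + 2 : ℕ) : ℕ∞) hs :=
    contDiff_of_eqOn_Iio_Ioi (by linarith : (1 / 2 : ℝ) < R₁)
      (contDiff_polynomial_eval p _) htC' hs_lo hs_hi
  have gsC : ContDiff ℝ ((n + 1 : ℕ) : ℕ∞) gs :=
    contDiff_of_eqOn_Iio_Ioi (by linarith : (1 / 2 : ℝ) < R₁)
      (contDiff_polynomial_eval q _) gtC' gs_lo gs_hi
  have hsB : ∀ x, B ≤ x → hs x = 0 := fun x hx => by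
    rw [hs_hi x (by linarith)]; exact ht0 x hx
  have gsB : ∀ x, B ≤ x → gs x = 0 := fun x hx => by
    rw [gs_hi x (by linarith)]; exact gt0 x hx
  -- ladders of the glued functions on `(½, ∞)`
  have hs_lad : ∀ x, 1 / 2 < x → ladder ι n hs x = h x := by
    intro x hx
    have hev : hs =ᶠ[𝓝 x] ht := Filter.mem_of_superset (Ioi_mem_nhds hx) fun y hy => hs_hi y hy
    rw [(ladder_eventuallyEq hev n (ι := ι)).eq_of_nhds, htlad]
  have gs_lad : ∀ x, 1 / 2 < x → ladder ι n gs x = g x := by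
    intro x hx
    have hev : gs =ᶠ[𝓝 x] gt := Filter.mem_of_superset (Ioi_mem_nhds hx) fun y hy => gs_hi y hy
    rw [(ladder_eventuallyEq hev n (ι := ι)).eq_of_nhds, gtlad]
  -- Step 4: the free wave and the ladder wave
  have hsC2 : ContDiff ℝ (n + 2) hs := by exact_mod_cast hsC
  have gsC1 : ContDiff ℝ (n + 1) gs := by exact_mod_cast gsC
  obtain ⟨Φ, F, G, hΦC, hFC, hGC, hrep, hFG, hGF, hfree, hd0, hv0, -, -⟩ :=
    exists_dAlembert_solution_contDiff hsC2 gsC1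
  have hΦC' : ContDiff ℝ ((n + 2 : ℕ) : ℕ∞) (Function.uncurry Φ) := by exact_mod_cast hΦC
  have hFC' : ContDiff ℝ ((n + 2 : ℕ) : ℕ∞) F := by exact_mod_cast hFC
  have hGC' : ContDiff ℝ ((n + 2 : ℕ) : ℕ∞) G := by exact_mod_cast hGC
  obtain ⟨hφC2, hφsol⟩ := ladder_wave hι hSo hric (n := n) hΦC' hfree
  -- data
  have hΦ0 : Φ 0 = hs := funext hd0
  have hdat0 : ∀ x, 1 / 2 < x → ladder ι n (Φ 0) x = h x := by
    intro x hx; rw [hΦ0]; exact hs_lad x hx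
  have hdat1 : ∀ x, 1 / 2 < x → deriv (fun τ => ladder ι n (Φ τ) x) 0 = g x := by
    intro x hx
    rw [deriv_ladder_param hι hΦC' 0 x]
    have : (fun y => deriv (fun τ => Φ τ y) 0) = gs := funext hv0
    rw [this]; exact gs_lad x hx
  -- Step 5: profiles beyond `B`
  have hFd : Differentiable ℝ F := hFC.differentiable (by simp)
  have hGd : Differentiable ℝ G := hGC.differentiable (by simp)
  have hsd : Differentiable ℝ hs := hsC2.differentiable (by simp)
  have hs'0 : ∀ x, B ≤ x → deriv hs x = 0 := deriv_eq_zero_of_eqOn_Ici hsd hsB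
  have hF'0 : ∀ x, B ≤ x → deriv F x = 0 := by
    intro x hx
    have h1 : deriv F x + deriv G x = deriv hs x := by
      have e : hs = fun y => F y + G y := funext fun y => (hFG y).symm
      rw [e, deriv_fun_add (hFd x) (hGd x)]
    have h2 := hGF x
    rw [hs'0 x hx] at h1; rw [gsB x hx] at h2
    linarith
  have hG'0 : ∀ x, B ≤ x → deriv G x = 0 := by
    intro x hx; have h2 := hGF x; rw [gsB x hx, hF'0 x hx] at h2; linarith
  have hconst : ∀ {f : ℝ → ℝ}, Differentiable ℝ f → Continuous (deriv f) →
      (∀ x, B ≤ x → deriv f x = 0) → ∀ x, B ≤ x → f x = f B := by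
    intro f hf hfc hf' x hx
    have hint : (∫ y in B..x, deriv f y) = 0 :=
      intervalIntegral.integral_zero_ae (Filter.Eventually.of_forall fun y hy => by
        rw [uIoc_of_le hx] at hy; exact hf' y hy.1.le)
    have hftc := intervalIntegral.integral_eq_sub_of_hasDerivAt
      (fun y _ => (hf y).hasDerivAt) (hfc.intervalIntegrable B x)
    linarith
  have h12 : (1 : WithTop ℕ∞) ≤ (n : WithTop ℕ∞) + 2 := by
    have : ((1 : ℕ) : WithTop ℕ∞) ≤ ((n + 2 : ℕ) : WithTop ℕ∞) := by
      exact_mod_cast (by omega : 1 ≤ n + 2)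
    exact_mod_cast this
  have hFB : ∀ x, B ≤ x → F x = F B := hconst hFd (hFC.continuous_deriv h12) hF'0
  have hGB : ∀ x, B ≤ x → G x = -F B := by
    intro x hx
    have h1 : G x = G B := hconst hGd (hGC.continuous_deriv h12) hG'0 x hx
    have h2 : F B + G B = 0 := by rw [hFG B, hsB B le_rfl]
    linarith
  -- Step 6: the support property (the regular wave vanishes outside the influence domain)
  obtain ⟨Q, hQder, hQdeg, hQpar⟩ := exists_primitive_polynomial q
  have hQeven : ∀ i, Odd i → Q.coeff i = 0 := hQpar hqodd
  set rF : ℝ[X] := Polynomial.C (1 / 2 : ℝ) * (p - Q) with hrF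
  set rG : ℝ[X] := p - rF with hrG
  have hR₁0 : (0 : ℝ) < R₁ := by linarith
  -- `F = rF + κ` and `G = rG − κ` on `(−∞, R₁)`
  have hsd' : ∀ y, y < R₁ → deriv hs y = (derivative p).eval y := by
    intro y hy
    have hev : hs =ᶠ[𝓝 y] fun z => p.eval z :=
      Filter.mem_of_superset (Iio_mem_nhds hy) fun z hz => hs_lo z hz
    rw [hev.deriv_eq]; exact (p.hasDerivAt y).deriv
  have hFder : ∀ y, y < R₁ → deriv F y = (derivative rF).eval y := by
    intro y hy
    have h1 : deriv F y + deriv G y = deriv hs y := by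
      have e : hs = fun z => F z + G z := funext fun z => (hFG z).symm
      rw [e, deriv_fun_add (hFd y) (hGd y)]
    have h2 := hGF y
    rw [hsd' y hy] at h1; rw [gs_lo y hy] at h2
    have : deriv F y = ((derivative p).eval y - q.eval y) / 2 := by linarith
    rw [this, hrF]
    simp only [derivative_mul, derivative_C, zero_mul, zero_add, derivative_sub, hQder, eval_mul,
      eval_C, eval_sub]
    ring
  set κ : ℝ := F 0 - rF.eval 0 with hκ
  have hFpoly : ∀ y, y < R₁ → F y = rF.eval y + κ := by
    have hD := eq_at_zero_of_deriv_eq_zero_Iio (D := fun y => F y - rF.eval y)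
      (hFd.sub (Polynomial.differentiable _)) hR₁0 (fun y hy => by
        rw [deriv_fun_sub (hFd y) (Polynomial.differentiableAt _), hFder y hy, Polynomial.deriv]; ring)
    intro y hy
    have hthis : F y - rF.eval y = F 0 - rF.eval 0 := hD y hy
    rw [hκ]; linarith
  have hGpoly : ∀ y, y < R₁ → G y = rG.eval y - κ := by
    intro y hy
    have h1 := hFG y
    rw [hs_lo y hy, hFpoly y hy] at h1
    rw [hrG, eval_sub]; linarith
  -- parity of `rF`, `rG`
  have hrFG : ∀ w, rF.eval (-w) = -rG.eval w := by
    intro w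
    rw [hrG, hrF]
    simp only [eval_sub, eval_mul, eval_C, eval_neg_of_even_coeff hpodd, eval_neg_of_odd_coeff hQeven]
    ring
  have hrGF : ∀ w, rG.eval (-w) = -rF.eval w := by
    intro w
    have := hrFG (-w)
    rw [neg_neg] at this
    linarith
  have hsupp : ∀ t x, 1 / 2 < x → x + |t| < R₁ → ladder ι n (Φ t) x = 0 := by
    intro t x hx hxt
    set r : ℝ[X] := rF.comp (X - Polynomial.C t) + rG.comp (X + Polynomial.C t) with hr
    -- `Φ t` is the polynomial `r` near `x`
    have hev : Φ t =ᶠ[𝓝 x] fun y => r.eval y := by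
      have hopen : IsOpen {y : ℝ | y + |t| < R₁} := isOpen_lt (continuous_id.add continuous_const) continuous_const
      filter_upwards [hopen.mem_nhds (show x + |t| < R₁ from hxt)] with y hy
      have hy' : y + |t| < R₁ := hy
      have hy1 : y - t < R₁ := by cases abs_cases t <;> linarith
      have hy2 : y + t < R₁ := by cases abs_cases t <;> linarith
      rw [hrep t y, hFpoly _ hy1, hGpoly _ hy2, hr]
      simp [eval_add, eval_comp, eval_sub, eval_X, eval_C]
    -- `r` is odd of degree `< 2n`
    have hrodd : ∀ i, Even i → r.coeff i = 0 := by
      refine even_coeff_eq_zero_of_eval_neg fun z => ?_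
      rw [hr]
      simp only [eval_add, eval_comp, eval_sub, eval_X, eval_C]
      have e1 : -z - t = -(z + t) := by ring
      have e2 : -z + t = -(z - t) := by ring
      rw [e1, e2, hrFG, hrGF]; ring
    have hrFdeg : rF.natDegree ≤ 2 * n := by
      rw [hrF]
      refine (natDegree_C_mul_le _ _).trans ((natDegree_sub_le _ _).trans (max_le (by omega) ?_))
      exact hQdeg.trans (by omega)
    have hrGdeg : rG.natDegree ≤ 2 * n := by
      rw [hrG]; exact (natDegree_sub_le _ _).trans (max_le (by omega) hrFdeg)
    have hlin1 : (X - Polynomial.C t : ℝ[X]).natDegree = 1 := natDegree_X_sub_C t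
    have hlin2 : (X + Polynomial.C t : ℝ[X]).natDegree = 1 := by
      rw [← sub_neg_eq_add, ← Polynomial.C_neg]; exact natDegree_X_sub_C (-t)
    have hrdeg2n : r.natDegree ≤ 2 * n := by
      rw [hr]
      refine (natDegree_add_le _ _).trans (max_le ?_ ?_)
      · exact (natDegree_comp_le).trans (by rw [hlin1, mul_one]; exact hrFdeg)
      · exact (natDegree_comp_le).trans (by rw [hlin2, mul_one]; exact hrGdeg)
    have hrdeg : r.natDegree < 2 * n := by
      have : r.natDegree ≤ 2 * n - 1 := by
        refine (natDegree_le_iff_coeff_eq_zero).2 fun i hi => ?_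
        rcases Nat.lt_or_ge (2 * n) i with hlt | hle
        · exact coeff_eq_zero_of_natDegree_lt (lt_of_le_of_lt hrdeg2n hlt)
        · have : i = 2 * n := by omega
          subst this
          exact hrodd _ ⟨n, by ring⟩
      omega
    rw [(ladder_eventuallyEq hev n (ι := ι)).eq_of_nhds]
    exact ladder_polynomial_eq_zero (by norm_num : (0 : ℝ) ≤ 1 / 2) hιeq' hrodd hrdeg hx
  -- Step 7: the energy identity
  set R : ℝ := 1 with hRdef
  have hR : (1 / 2 : ℝ) < R := by rw [hRdef]; norm_num
  have hRR₁r : R < R₁ := by rw [hRdef]; exact hR₁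
  have hsC1 : ContDiff ℝ ((n + 1 : ℕ) : ℕ∞) hs := hsC.of_le (by exact_mod_cast Nat.le_succ _)
  have hpos := integral_energy_ladder_eq_of_contDiff hι hιeq hsC1 hpodd hpdeg hR hRR₁r hR₁B hs_lo hsB
  have gsCn : ContDiff ℝ n gs := gsC.of_le (by exact_mod_cast Nat.le_succ _)
  have hvel := integral_sq_ladder_eq_of_contDiff hι hιeq gsCn hqodd hqdeg hR hRR₁r hR₁B gs_lo gsB
  -- identify the left-hand sides with the data
  have hladfun : ∀ x, 1 / 2 < x → ladder ι n hs x = h x := hs_lad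
  have hderlad : ∀ x, 1 / 2 < x → deriv (ladder ι n hs) x = deriv h x := by
    intro x hx
    have hev : ladder ι n hs =ᶠ[𝓝 x] h :=
      Filter.mem_of_superset (Ioi_mem_nhds hx) fun y hy => hs_lad y hy
    exact hev.deriv_eq
  have hposL : (∫ x in R..B, deriv (ladder ι n hs) x ^ 2 + n * (n + 1) * ι x ^ 2 * (ladder ι n hs x) ^ 2)
      = ∫ x in R..B, deriv h x ^ 2 + n * (n + 1) * ι x ^ 2 * h x ^ 2 := by
    refine intervalIntegral.integral_congr fun x hx => ?_
    rw [uIcc_of_le (by linarith : R ≤ B)] at hx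
    have hx' : 1 / 2 < x := lt_of_lt_of_le hR hx.1
    simp only [hderlad x hx', hladfun x hx']
  have hvelL : (∫ x in R..B, (ladder ι n gs x) ^ 2) = ∫ x in R..B, g x ^ 2 := by
    refine intervalIntegral.integral_congr fun x hx => ?_
    rw [uIcc_of_le (by linarith : R ≤ B)] at hx
    have hx' : 1 / 2 < x := lt_of_lt_of_le hR hx.1
    simp only [gs_lad x hx']
  -- the data vanish on `[R, R₁)`
  have hhd : Differentiable ℝ h := hh.differentiable (by norm_num)
  have hderh0 : ∀ x, x < R₁ → deriv h x = 0 := by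
    intro x hx
    have hev : h =ᶠ[𝓝 x] fun _ => (0 : ℝ) :=
      Filter.mem_of_superset (Iio_mem_nhds hx) fun y hy => hh0 y (le_of_lt hy)
    rw [hev.deriv_eq, deriv_const]
  have hch : Continuous fun x => deriv h x ^ 2 + n * (n + 1) * ι x ^ 2 * h x ^ 2 :=
    ((hh.continuous_deriv (by norm_num)).pow 2).add
      (((continuous_const.mul continuous_const).mul (hι.continuous.pow 2)).mul (hh.continuous.pow 2))
  have hcg : Continuous fun x => g x ^ 2 := hg.continuous.pow 2
  have hRR₁ : R ≤ R₁ := by rw [hRdef]; linarith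
  have hzero1 : (∫ x in R..R₁, deriv h x ^ 2 + n * (n + 1) * ι x ^ 2 * h x ^ 2) = 0 :=
    intervalIntegral_eq_zero_of_Ioo hRR₁ fun x hx => by
      rw [hderh0 x hx.2, hh0 x hx.2.le]; ring
  have hzero2 : (∫ x in R..R₁, g x ^ 2) = 0 :=
    intervalIntegral_eq_zero_of_Ioo hRR₁ fun x hx => by rw [hg0 x hx.2.le]; ring
  have hsplit1 : (∫ x in R..B, deriv h x ^ 2 + n * (n + 1) * ι x ^ 2 * h x ^ 2)
      = ∫ x in R₁..B, deriv h x ^ 2 + n * (n + 1) * ι x ^ 2 * h x ^ 2 := by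
    rw [← intervalIntegral.integral_add_adjacent_intervals (hch.intervalIntegrable R R₁)
      (hch.intervalIntegrable R₁ B), hzero1, zero_add]
  have hsplit2 : (∫ x in R..B, g x ^ 2) = ∫ x in R₁..B, g x ^ 2 := by
    rw [← intervalIntegral.integral_add_adjacent_intervals (hcg.intervalIntegrable R R₁)
      (hcg.intervalIntegrable R₁ B), hzero2, zero_add]
  -- the profile identity `2F² + 2G² = hs² + gs²` at the top derivatives
  have hsumF : ∀ y, iteratedDeriv (n + 1) F y + iteratedDeriv (n + 1) G y
      = iteratedDeriv (n + 1) hs y := by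
    intro y
    have e : hs = fun z => F z + G z := funext fun z => (hFG z).symm
    rw [e, iteratedDeriv_fun_add (hFC.contDiffAt.of_le (by exact_mod_cast Nat.le_succ _))
      (hGC.contDiffAt.of_le (by exact_mod_cast Nat.le_succ _))]
  have hdifF : ∀ y,
      iteratedDeriv (n + 1) G y - iteratedDeriv (n + 1) F y = iteratedDeriv n gs y := by
    intro y
    have e : gs = fun z => deriv G z - deriv F z := funext fun z => (hGF z).symm
    have hdG : ContDiff ℝ n (deriv G) :=
      (contDiff_succ_iff_deriv.1 (hGC.of_le (by exact_mod_cast Nat.le_succ _) :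
        ContDiff ℝ ((n : WithTop ℕ∞) + 1) G)).2.2
    have hdF : ContDiff ℝ n (deriv F) :=
      (contDiff_succ_iff_deriv.1 (hFC.of_le (by exact_mod_cast Nat.le_succ _) :
        ContDiff ℝ ((n : WithTop ℕ∞) + 1) F)).2.2
    rw [e, iteratedDeriv_fun_sub hdG.contDiffAt hdF.contDiffAt, iteratedDeriv_succ',
      iteratedDeriv_succ']
  have cF : Continuous (iteratedDeriv (n + 1) F) :=
    hFC.continuous_iteratedDeriv _ (by exact_mod_cast Nat.le_succ _)
  have cG : Continuous (iteratedDeriv (n + 1) G) :=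
    hGC.continuous_iteratedDeriv _ (by exact_mod_cast Nat.le_succ _)
  have hchan : 2 * (∫ y in (0 : ℝ)..B, iteratedDeriv (n + 1) F y ^ 2)
      + 2 * (∫ y in (0 : ℝ)..B, iteratedDeriv (n + 1) G y ^ 2)
      = (∫ y in (0 : ℝ)..B, iteratedDeriv (n + 1) hs y ^ 2)
        + ∫ y in (0 : ℝ)..B, iteratedDeriv n gs y ^ 2 := by
    have i1 : IntervalIntegrable (fun y => 2 * iteratedDeriv (n + 1) F y ^ 2) volume 0 B :=
      ((cF.pow 2).const_mul 2).intervalIntegrable _ _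
    have i2 : IntervalIntegrable (fun y => 2 * iteratedDeriv (n + 1) G y ^ 2) volume 0 B :=
      ((cG.pow 2).const_mul 2).intervalIntegrable _ _
    have i3 : IntervalIntegrable (fun y => iteratedDeriv (n + 1) hs y ^ 2) volume 0 B :=
      ((hsC2.continuous_iteratedDeriv _ (by exact_mod_cast Nat.le_succ _)).pow 2)
        |>.intervalIntegrable _ _
    have i4 : IntervalIntegrable (fun y => iteratedDeriv n gs y ^ 2) volume 0 B :=
      ((gsC1.continuous_iteratedDeriv _ (by exact_mod_cast Nat.le_succ _)).pow 2)
        |>.intervalIntegrable _ _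
    rw [← intervalIntegral.integral_const_mul, ← intervalIntegral.integral_const_mul,
      ← intervalIntegral.integral_add i1 i2, ← intervalIntegral.integral_add i3 i4]
    refine intervalIntegral.integral_congr fun y _ => ?_
    have a := hsumF y; have b := hdifF y
    show 2 * iteratedDeriv (n + 1) F y ^ 2 + 2 * iteratedDeriv (n + 1) G y ^ 2
      = iteratedDeriv (n + 1) hs y ^ 2 + iteratedDeriv n gs y ^ 2
    rw [← a, ← b]; ring
  -- assemble
  refine ⟨Φ, F, G, hΦC', hFC', hGC', hrep, hFB, hGB, hφC2, hφsol, hdat0, hdat1, hsupp, ?_⟩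
  rw [intervalIntegral.integral_add (hch.intervalIntegrable _ _) (hcg.intervalIntegrable _ _),
    ← hsplit1, ← hsplit2, ← hposL, ← hvelL, hpos, hvel, hchan]

end Literature.Analysis.PDE
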